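import Summits.MatrixMultiplication.OmegaCensus.SmallFormats.InvertiblePointNearPruneUnionCaps
import HarnessLib

/-!
# ω-census family (a): the SPAN TEST of the near-stage ω-engines is a kernel inference rule

Cell `pub-omega` (unit `pub-omega-eng1-g29`, ENG1), topic `Summits/MatrixMultiplication/OmegaCensus` (sub-folder `SmallFormats`).
Framing (verbatim): lottery ticket; floor = certified bounds/negative ranges. HONEST FRAMING: one line of linear algebra. Both near-stage ω-engines of the
`𝔽₃` `⟨2,2,6⟩ @ 20` census decide a large share of their branches by the SPAN TEST before any search (tensor v4 README §1 (2) 'union rank < 12 ⇒ case dead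
with 0 nodes'; ENG1 RESULT-fp5 §3 (SPAN); in the p7 harvest j276215: 26 682 ω-orbit representatives 'span-dead', and 27 134 of ENG1's 41 752 transported
branch representatives): if all candidate lists together span a space of dimension `< #unknowns`, no linearly independent tuple can be chosen from them,
so the prune system (`PruneSol` of p529277, `PruneSolU` of `…UnionCaps`) has no solution — whatever the caps. Here that rule is a theorem
(`not_pruneSol_of_finrank_span_lt`, `not_pruneSolU_of_finrank_span_lt`, and the ω-branch forms `not_omegaSol_of_finrank_span_lt` /
`not_omegaSolU_of_finrank_span_lt`), so a 'span-dead' verdict rests on the kernel rule plus the engine's rank computation of ONE explicit finite family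
of vectors (the union of its printed lists). Nothing here is a bound on a rank or on `ω` the exponent.
-/

namespace Summit.MatrixMultiplication.OmegaCensus.SmallFormats

open Module Matrix

section SpanTest

variable {k : Type*} [Field k] {V : Type*} [AddCommGroup V] [Module k V]
  {ι : Type*} [Fintype ι] {A : Type*} {κ : A → Type*} {U : A → Type*} [∀ a, AddCommGroup (U a)] [∀ a, Module k (U a)]

/-- **A linearly independent tuple chosen from sets inside `S` forces `#ι ≤ dim span S`.** -/
theorem card_le_finrank_span_of_linearIndependent [Module.Finite k V] (S : Set V) {W : ι → V} (hW : LinearIndependent k W)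
    (hWS : ∀ s, W s ∈ S) : Fintype.card ι ≤ finrank k ↥(Submodule.span k S) := by
  -- restrict the family to the span
  let W' : ι → ↥(Submodule.span k S) := fun s => ⟨W s, Submodule.subset_span (hWS s)⟩
  have hW' : LinearIndependent k W' := by
    refine LinearIndependent.of_comp (Submodule.span k S).subtype ?_
    exact hW
  exact hW'.fintype_card_le_finrank

/-- **THE SPAN TEST (p529277 system).** If every candidate set lies in `S` and `dim span S < #ι`, the prune system is unsolvable — for ANY caps. -/
theorem not_pruneSol_of_finrank_span_lt [Module.Finite k V] {L : ι → Set V} (S : Set V) (hL : ∀ s, L s ⊆ S)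
    (hS : finrank k ↥(Submodule.span k S) < Fintype.card ι) (T : (a : A) → ι → (V →ₗ[k] U a)) (cap : A → ℕ) :
    ¬ PruneSol L T cap := by
  rintro ⟨W, hWL, hWind, -⟩
  exact absurd (card_le_finrank_span_of_linearIndependent S hWind fun s => hL s (hWL s)) (not_le.mpr hS)

/-- **THE SPAN TEST (union-cap system of `…UnionCaps`).** -/
theorem not_pruneSolU_of_finrank_span_lt [Module.Finite k V] {L : ι → Set V} (S : Set V) (hL : ∀ s, L s ⊆ S)
    (hS : finrank k ↥(Submodule.span k S) < Fintype.card ι) (σ : (a : A) → κ a → ι) (T : (a : A) → κ a → (V →ₗ[k] U a))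
    (Q : (a : A) → Submodule k (U a)) (cap : A → ℕ) : ¬ PruneSolU L σ T Q cap := by
  rintro ⟨W, hWL, hWind, -⟩
  exact absurd (card_le_finrank_span_of_linearIndependent S hWind fun s => hL s (hWL s)) (not_le.mpr hS)

/-- The natural `S`: the union of all candidate sets. -/
theorem not_pruneSol_of_finrank_span_iUnion_lt [Module.Finite k V] {L : ι → Set V}
    (hS : finrank k ↥(Submodule.span k (⋃ s, L s)) < Fintype.card ι) (T : (a : A) → ι → (V →ₗ[k] U a)) (cap : A → ℕ) :
    ¬ PruneSol L T cap :=
  not_pruneSol_of_finrank_span_lt (⋃ s, L s) (fun s => Set.subset_iUnion L s) hS T cap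

end SpanTest

section SpanTestOmega

variable {k : Type*} [Field k] {m n : ℕ}

/-- **Span test for the ω-branch system (p529277 shape):** if the union of the ω-filtered lists spans `< #ι` dimensions, branch `ω` is dead. -/
theorem not_omegaSol_of_finrank_span_lt {ι A : Type*} [Fintype ι] (P : Submodule k (Matrix (Fin m) (Fin n) k))
    (f : ι → Module.Dual k (Matrix (Fin m) (Fin m) k)) (Φ : ι → (Matrix (Fin m) (Fin m) k → k) → Prop) (p : A → ℕ)
    (M : (a : A) → ι → Fin (p a) → Matrix (Fin m) (Fin m) k) (cap : A → ℕ) (ω : Module.Dual k (Matrix (Fin m) (Fin n) k))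
    (hS : finrank k ↥(Submodule.span k (⋃ s, omegaList P (f s) (Φ s) ω)) < Fintype.card ι) :
    ¬ OmegaSol P f Φ p M cap ω := by
  unfold OmegaSol MatPruneSol
  exact not_pruneSol_of_finrank_span_iUnion_lt hS _ cap

/-- **Span test for the ω-branch system with union caps (`…UnionCaps` shape).** -/
theorem not_omegaSolU_of_finrank_span_lt {ι A : Type*} [Fintype ι] {κ : A → Type*} (P : Submodule k (Matrix (Fin m) (Fin n) k))
    (f : ι → Module.Dual k (Matrix (Fin m) (Fin m) k)) (Φ : ι → (Matrix (Fin m) (Fin m) k → k) → Prop) (p : A → ℕ)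
    (σ : (a : A) → κ a → ι) (M : (a : A) → κ a → Fin (p a) → Matrix (Fin m) (Fin m) k)
    (Q : (a : A) → Submodule k (Fin (p a) → Matrix (Fin m) (Fin n) k)) (cap : A → ℕ) (ω : Module.Dual k (Matrix (Fin m) (Fin n) k))
    (hS : finrank k ↥(Submodule.span k (⋃ s, omegaList P (f s) (Φ s) ω)) < Fintype.card ι) :
    ¬ OmegaSolU P f Φ p σ M Q cap ω := by
  unfold OmegaSolU MatPruneSolU
  exact not_pruneSolU_of_finrank_span_lt (⋃ s, omegaList P (f s) (Φ s) ω) (fun s => Set.subset_iUnion _ s) hS σ _ Q cap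

end SpanTestOmega

end Summit.MatrixMultiplication.OmegaCensus.SmallFormats
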